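import Summits.QuantumFields.BalabanUV.Beta.FP.TorusCompositeRowsPeriodic
import Summits.QuantumFields.BalabanUV.Beta.CompositeCorrectorLocality

/-!
# `BalabanUV.Beta.FP.TorusCompositeRowsLattice` — road «FP» for binder row D1, ROUTE T: **THE ENTRIES OF THE TOWER's AVERAGING ROWS `compRows` AS PERIOD SUMS
# OF an2∕an3's LATTICE COMPOSITE `compLinAvgAt` OF BOND INDICATORS, AND THE `perF` PACKAGING** — the `hQ`-type block identification
# `(perF T K).submatrix fμ (ff) = compRows Lc M lev rs (n+1)` for ANY lattice kernel `K` whose multiplier–field block is the (scaled) composite rooted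
# linear averaging read at the coarse points (sequel of `FP/TorusCompositeRowsPeriodic`; the chart-side half of the (C1)-0 junction, an2 g48 W-3 (c) l.53579)

WHAT (every `d`, blocking `Lc ≠ 0`, box `M`, depth `n+1`, levels `lev`, in-block roots `rs` from the top ∕ `r` from the bottom with `r i = rs (j+1)` for `i + j = n`;
`T = towerTorus Lc M (n+1)`, `S = ∏_{i<n+1} stepScale d Lc (lev (i+1))`):
* §1 lattice-side bookkeeping: `compLinAvgAt_congr_roots` (only the levels used matter), `compLinAvgAt_zero_form ∕ _finset_sum` (finite additivity, from
  `CompositeCorrectorLinear`), `translate_injective`, and **`tsum_compLinAvgAt_delta1_translate`** — THE EXCHANGE OF THE PERIOD SUM WITH THE COMPOSITE AVERAGE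
  (in-block roots, `0 < L`): `Σ'_t compLinAvgAt r L k δ_{(β, z + T∘t)} κ x = compLinAvgAt r L k ((l,w) ↦ δ_{(β,z)}(l, wrap T w)) κ x` — a FINITE re-arrangement:
  by `CompositeCorrectorLocality.depOn_compLinAvgAt` the composite at `(κ, x)` reads only bonds of the `L^k`-block pair at `x` (a finite window, `le_of_blk ∕ lt_of_blk`),
  met by finitely many translates (`Finset.preimage` under the injective `translate T z`); `tsum_eq_sum`, finite additivity, agreement on the read set.
* §2 **`compRows_apply_eq_tsum`**: `compRows Lc M lev rs (n+1) (x,κ) (z,β) = S · Σ'_t compLinAvgAt r Lc (n+1) δ_{(β, z + T∘t)} κ x`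
  (`TorusCompositeRowsPeriodic.compRows_apply_eq_compLinAvgAt_wrap` + §1; the roots beyond level `n` are irrelevant — `compLinAvgAt_congr_roots` puts in-block ones);
  **`smul_perF_submatrix_eq_smul_compRows`**: for ANY `K : MKer (d+1) (Fib d)` with `K x w (inr κ) (inl β) = [proj (bigRatio Lc n) x = 0]·s·compLinAvgAt r Lc (n+1) δ_{(β,w)} κ
  (quo (bigRatio Lc n) x)` (the SHAPE of `CompositeCorrectorBordered.trK_phiK_bhK_phiK_inr_inl` at `L^m = bigRatio Lc n = Lc^{n+1}`, scale `s` DISPLAYED) and ANY coarse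
  presentation `fμ : pbox M × Fin (d+1) → Idx T (Fib d)` reading `a ↦ (Lc^{n+1} • a.1, inr a.2)` (hypotheses `hfμ₁ hfμ₂`): `S • (perF T K).submatrix fμ (ff) = s • compRows …`;
  **`perF_submatrix_eq_compRows`**: ON THE NOSE when `s = S`.  SYSTEM N (the door's `𝔔₀ = Q₂₀ * Q₁₀`, one more step on top read through the slot presentation
  `(pμ, mμ)` with `proj Lc (pμ a) = 0`, scale `bigRatio Lc (n+1)`, slots `fN a = (Lc^{n+1} • pμ a, inr (mμ a))`, unit `∏_{i<n+2} stepScale d Lc (lev i)`, dictionary `r i = rs j`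
  for `i + j = n+1`): `topStep_mul_compRows_apply_eq_tsum`, `smul_perF_submatrix_eq_smul_topStep_mul_compRows`, `perF_submatrix_eq_topStep_mul_compRows`.
So: once the row's (C1) chart `𝕄_X` displays its border in that shape with the tower's scale, #41d's `Q₁₀ ∕ 𝔔₀`-side block identification against leaf-05's
`Q♯ := (perF T 𝕄).submatrix fμ (ff)` is ONE term of this file; the scale bridge (if the record's border is unscaled, `s = 1`) is the displayed `smul` form.

[folklore] finite sums + finitely supported `tsum` re-arrangements BY NAME over OUR bookkeeping objects and the row's typed lattice objects; no `def`, no `def … : Prop`,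
nothing cited, 0 sorry.  NO chart is fixed here; nothing of the dictionary ∕ Bałaban's non-linear averages asserted beyond their typed linearisations.
NOT HERE: the `hH` (field–field) block identification, the seven chart letters, the legs, (P2‴), the END.

HONEST DEPENDENCY (page 1, mandatory): continuum YM on T⁴ ⇐ BetaPertH ∧ nine spine estimates (0/9 proved); BetaPertH ⇐ (D1) ∧ (D4) ∧ CAP+tail;
G-an2-4 gates asym, D1 and NE2/3/4.  HONEST FRAMING (cell contract, verbatim): «discharging `BetaPertH` makes Bałaban's UV stability UNCONDITIONAL —
a real constructive-QFT result; it is NOT the continuum limit and NOT the Clay problem.»  ABSOLUTE RULE (cell charter, verbatim): «No internally-minted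
statement may enter as a cited fact. Every hypothesis is either kernel-proved in this package or a verbatim quotation of a PUBLISHED theorem with page
reference. The manuscript(s) under audit are NOT citable for their own disputed steps — they are the thing under adjudication; programme-internal
(2001/route/tribunal) claims are never citable.»  0 estimates; 0∕4 row-D1 binders (hW, hR, D1Tel, D1Rep); NOT (T-ID), NOT (C1), NOT SDF, NOT D1,
NOT BetaPertH, NOT continuum, NOT Clay.  D1 formalisation swarm LEAF PROVER 02 (b2b-balaban-beta-d1-formalise-leaf-02 gen 27), 2026-08-23.  No existing file touched.
-/

noncomputable section

open scoped BigOperators Matrix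

namespace Summit.QuantumFields.BalabanUV.Beta.FP.TorusCompositeRowsLattice

open Matrix Finset
open Literature.Probability.LatticeModels (Torus.proj)
open Literature.MathematicalPhysics.QuantumFieldTheory
open Literature.MathematicalPhysics.QuantumFieldTheory.Balaban1983to89
open Literature.MathematicalPhysics.QuantumFieldTheory.Balaban1983to89.Beta
open B6Lemma24Torus (pbox mem_pbox wrap wrap_eq_self)
open B4TorusKernel.MultiPeriod (translate translate_apply)
open AffineAveraging (Site Form1 box toSite)
open AveragingContours (blk)
open ExpKernelCalculus (MKer)
open KKTFluctuationKernel (delta1 delta1_apply)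
open LatticeForm (quo)
open OneStepResolventKernel (Fib proj_zsmul quo_zsmul eq_zsmul_quo_of_proj)
open Summit.QuantumFields.BalabanUV.Beta.BorderedHessian (stepScale bhKStepAt)
open Summit.QuantumFields.BalabanUV.Beta.FP.KernelPeriodisationFib (Idx perF perF_apply perZ perZ_apply)
open Summit.QuantumFields.BalabanUV.Beta.FP.TorusCompositeObjects (towerTorus compRows bigRatio bigRatio_eq_pow)
open Summit.QuantumFields.BalabanUV.Beta.CompositeAveragingCoarseExact (compLinAvgAt compLinAvgAt_succ)
open Summit.QuantumFields.BalabanUV.Beta.CompositeCorrectorLinear (compLinAvgAt_add compLinAvgAt_smul)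
open Summit.QuantumFields.BalabanUV.Beta.CompositeCorrectorLocality (DepOn InPair InPairBond depOn_compLinAvgAt le_of_blk lt_of_blk)
open Summit.QuantumFields.BalabanUV.Beta.GAN24.KernelPeriodisation (translate_wrap_quo wrap_translate)
open Summit.QuantumFields.BalabanUV.Beta.FP.TorusCompositeRowsPeriodic (compRows_apply_eq_compLinAvgAt_wrap sum_topStep_mul_compRows_mul_periodic)

variable {d : ℕ}

/-! ## §1 Lattice-side bookkeeping: roots, finite additivity, and the EXCHANGE of the period sum with the composite average -/

section Kernel

/-- [folklore] the composite average depends on the roots only through the levels it uses. -/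
theorem compLinAvgAt_congr_roots {r r' : ℕ → (Fin (d + 1) → ℕ)} (L : ℕ) :
    ∀ (m : ℕ), (∀ i, i < m → r i = r' i) → ∀ A : Form1 (d + 1) ℝ, compLinAvgAt r L m A = compLinAvgAt r' L m A
  | 0, _, _ => rfl
  | m + 1, h, A => by
      rw [compLinAvgAt_succ, compLinAvgAt_succ, h m (Nat.lt_succ_self m),
        compLinAvgAt_congr_roots L m (fun i hi => h i (Nat.lt_succ_of_lt hi)) A]

/-- [folklore] the composite average of the zero form vanishes. -/
theorem compLinAvgAt_zero_form (r : ℕ → (Fin (d + 1) → ℕ)) (L m : ℕ) : compLinAvgAt r L m (0 : Form1 (d + 1) ℝ) = 0 := by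
  have h := compLinAvgAt_smul r L (0 : ℝ) (0 : Form1 (d + 1) ℝ) m
  rwa [zero_smul, zero_smul] at h

/-- [folklore] the composite average is additive over finite families. -/
theorem compLinAvgAt_finset_sum {ι : Type*} (r : ℕ → (Fin (d + 1) → ℕ)) (L m : ℕ) (S : Finset ι) (A : ι → Form1 (d + 1) ℝ) :
    compLinAvgAt r L m (∑ i ∈ S, A i) = ∑ i ∈ S, compLinAvgAt r L m (A i) := by
  classical
  induction S using Finset.induction_on with
  | empty => rw [Finset.sum_empty, Finset.sum_empty, compLinAvgAt_zero_form]
  | insert i S hi ih => rw [Finset.sum_insert hi, Finset.sum_insert hi, compLinAvgAt_add, ih]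

/-- [folklore] translation by the period lattice is injective in the period. -/
theorem translate_injective (T : Fin (d + 1) → ℕ) [∀ μ, NeZero (T μ)] (z : Fin (d + 1) → ℤ) :
    Function.Injective (translate T z) := fun t t' h => by
  funext i
  have hi := congrFun h i
  rw [translate_apply, translate_apply] at hi
  have hT : (T i : ℤ) ≠ 0 := by exact_mod_cast NeZero.ne (T i)
  exact mul_left_cancel₀ hT (by linarith)

/-- [folklore] **EXCHANGE OF THE PERIOD SUM WITH THE COMPOSITE AVERAGE** (in-block roots, `0 < L`): the period sum over the translates of the bond
`(β, z)` (`z` a point of the box `T`) of the composite averages of their indicators IS the composite average of the `T`-PERIODIC INDICATOR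
`(l, w) ↦ δ_{(β,z)} (l, wrap T w)` — a finite re-arrangement: the composite at `(κ, x)` reads only the bonds of the `L^k`-block pair at `x`
(`depOn_compLinAvgAt`), which finitely many translates meet. -/
theorem tsum_compLinAvgAt_delta1_translate {L : ℕ} (hL : 0 < L) (r : ℕ → (Fin (d + 1) → ℕ)) (hr : ∀ k, r k ∈ box (d + 1) L) (k : ℕ)
    (T : Fin (d + 1) → ℕ) [∀ μ, NeZero (T μ)] (β : Fin (d + 1)) (z : ↥(pbox T)) (κ : Fin (d + 1)) (x : Fin (d + 1) → ℤ) :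
    ∑' t : Fin (d + 1) → ℤ, compLinAvgAt r L k (delta1 β (translate T (z : Fin (d + 1) → ℤ) t)) κ x
      = compLinAvgAt r L k (fun l w => delta1 β (z : Fin (d + 1) → ℤ) l (wrap T w)) κ x := by
  classical
  -- the window of fine sites the composite at `(κ, x)` can read, as a finite set
  set N : ℕ := L ^ k with hN
  have hNpos : 0 < N := pow_pos hL k
  set W : Finset (Fin (d + 1) → ℤ) := Fintype.piFinset fun j => Finset.Ico ((N : ℤ) * x j) ((N : ℤ) * x j + 2 * N) with hW
  have hWmem : ∀ w : Fin (d + 1) → ℤ, w ∈ InPair N κ x → w ∈ W := fun w hw => by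
    rw [hW, Fintype.mem_piFinset]
    intro j
    rw [Finset.mem_Ico]
    have h1 := (hw j).1
    have h2 := (hw j).2
    have hb1 := le_of_blk hNpos w j
    have hb2 := lt_of_blk hNpos w j
    have hle : blk N w j ≤ x j + 1 := h2.trans (by split_ifs <;> omega)
    have hN0 : (0 : ℤ) ≤ N := by exact_mod_cast hNpos.le
    constructor
    · calc (N : ℤ) * x j ≤ (N : ℤ) * blk N w j := mul_le_mul_of_nonneg_left h1 hN0
        _ ≤ w j := hb1
    · calc w j < (N : ℤ) * blk N w j + N := hb2
        _ ≤ (N : ℤ) * (x j + 1) + N := by nlinarith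
        _ = (N : ℤ) * x j + 2 * N := by ring
  -- the finitely many periods whose translate of `z` meets the window
  have hinj := translate_injective T (z : Fin (d + 1) → ℤ)
  set S : Finset (Fin (d + 1) → ℤ) := W.preimage (translate T (z : Fin (d + 1) → ℤ)) (hinj.injOn) with hS
  have hmemS : ∀ t, translate T (z : Fin (d + 1) → ℤ) t ∈ W → t ∈ S := fun t ht => by
    rw [hS, Finset.mem_preimage]; exact ht
  have hdep := depOn_compLinAvgAt hL r hr k κ x
  -- off `S` the composite average of the translated indicator vanishes
  have hzero : ∀ t ∉ S, compLinAvgAt r L k (delta1 β (translate T (z : Fin (d + 1) → ℤ) t)) κ x = 0 := fun t ht => by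
    have h := hdep.eq (A := delta1 β (translate T (z : Fin (d + 1) → ℤ) t)) (B := 0) (fun l' w' hP => by
      rw [delta1_apply, Pi.zero_apply, Pi.zero_apply]
      refine if_neg fun hc => ht (hmemS t ?_)
      rw [← hc.2]
      exact hWmem w' hP.1)
    rw [h, compLinAvgAt_zero_form]
    rfl
  rw [tsum_eq_sum (s := S) hzero]
  -- finite additivity, then agreement on the read set
  have hsum : ∑ t ∈ S, compLinAvgAt r L k (delta1 β (translate T (z : Fin (d + 1) → ℤ) t)) κ x
      = compLinAvgAt r L k (∑ t ∈ S, delta1 β (translate T (z : Fin (d + 1) → ℤ) t)) κ x := by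
    rw [compLinAvgAt_finset_sum, Finset.sum_apply, Finset.sum_apply]
  rw [hsum]
  refine hdep.eq fun l' w' hP => ?_
  rw [Finset.sum_apply, Finset.sum_apply, delta1_apply]
  simp only [delta1_apply]
  by_cases hl : l' = β
  · subst hl
    by_cases hw : wrap T w' = (z : Fin (d + 1) → ℤ)
    · -- `w'` is the translate of `z` by `quo T w'`, which lies in `S`; it is the only one
      have hw' : w' = translate T (z : Fin (d + 1) → ℤ) (Summit.QuantumFields.BalabanUV.Beta.GAN24.KernelPeriodisation.quo T w') := by
        rw [← hw]; exact (translate_wrap_quo T w').symm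
      have ht0 : Summit.QuantumFields.BalabanUV.Beta.GAN24.KernelPeriodisation.quo T w' ∈ S := hmemS _ (hw' ▸ hWmem w' hP.1)
      rw [if_pos ⟨rfl, hw⟩, Finset.sum_eq_single_of_mem _ ht0]
      · rw [if_pos ⟨rfl, hw'⟩]
      · intro t _ hne
        refine if_neg fun hc => hne (hinj ?_)
        rw [← hc.2, ← hw']
    · rw [if_neg (fun h => hw h.2)]
      refine Finset.sum_eq_zero fun t _ => if_neg fun hc => hw ?_
      rw [hc.2, wrap_translate T z.2]
  · rw [if_neg (fun h => hl h.1)]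
    exact Finset.sum_eq_zero fun t _ => if_neg fun hc => hl hc.1

end Kernel


/-! ## §2 The entries of `compRows` as period sums, and the `perF` packaging (the `hQ`-type block identification) -/

section Entries

variable (Lc : ℕ) [NeZero Lc]

/-- [folklore] **THE ENTRIES OF `compRows` AS PERIOD SUMS** — the `perZ` form: `compRows Lc M lev rs (n+1) (x, κ) (z, β) =
(∏_{i<n+1} stepScale d Lc (lev (i+1))) · Σ'_t compLinAvgAt r Lc (n+1) (δ_{(β, z + T∘t)}) κ x` (§3's exchange; the bottom-indexed roots are put in the
blocks by the dictionary `hr` and `compLinAvgAt_congr_roots`). -/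
theorem compRows_apply_eq_tsum (n : ℕ) (M : Fin (d + 1) → ℕ) [∀ μ, NeZero (M μ)] (lev : ℕ → ℕ)
    (rs : ℕ → (Fin (d + 1) → ℕ)) (hrs : ∀ k, rs k ∈ box (d + 1) Lc) (r : ℕ → (Fin (d + 1) → ℕ))
    (hr : ∀ i j : ℕ, i + j = n → r i = rs (j + 1)) (x : ↥(pbox M)) (κ : Fin (d + 1))
    (z : ↥(pbox (towerTorus Lc M (n + 1)))) (β : Fin (d + 1)) :
    compRows Lc M lev rs (n + 1) (x, κ) (z, β)
      = (∏ i ∈ Finset.range (n + 1), stepScale d Lc (lev (i + 1))) *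
          ∑' t : Fin (d + 1) → ℤ, compLinAvgAt r Lc (n + 1) (delta1 β (translate (towerTorus Lc M (n + 1)) (z : Fin (d + 1) → ℤ) t)) κ
            (x : Fin (d + 1) → ℤ) := by
  classical
  -- in-block roots agreeing with `r` on the levels used
  set r' : ℕ → (Fin (d + 1) → ℕ) := fun i => if i ≤ n then r i else rs 0 with hr'def
  have hr'box : ∀ k, r' k ∈ box (d + 1) Lc := fun k => by
    simp only [hr'def]
    split_ifs with hk
    · rw [hr k (n - k) (by omega)]; exact hrs _
    · exact hrs 0
  have hagree : ∀ i, i < n + 1 → r i = r' i := fun i hi => by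
    simp only [hr'def]; rw [if_pos (by omega)]
  have hLc : 0 < Lc := Nat.pos_of_ne_zero (NeZero.ne Lc)
  rw [compRows_apply_eq_compLinAvgAt_wrap Lc n M lev rs hrs r hr x κ z β, compLinAvgAt_congr_roots Lc (n + 1) hagree,
    ← tsum_compLinAvgAt_delta1_translate hLc r' hr'box (n + 1) (towerTorus Lc M (n + 1)) β z κ (x : Fin (d + 1) → ℤ)]
  congr 1
  refine tsum_congr fun t => ?_
  rw [compLinAvgAt_congr_roots Lc (n + 1) hagree]

/-- [folklore] **THE `perF` PACKAGING — THE BLOCK IDENTIFICATION `Q♯ = compRows`**: for ANY lattice kernel `K` on `ℤ^{d+1}` whose multiplier–field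
block is `s ·` the composite rooted linear averaging of bond indicators read at the coarse points of scale `bigRatio Lc n = Lc^{n+1}`
(`K x w (inr κ) (inl β) = [proj x = 0]·s·compLinAvgAt r Lc (n+1) δ_{(β,w)} κ (x ∕ Lc^{n+1})` — the shape of an2's re-linearised composite border
`CompositeCorrectorBordered.trK_phiK_bhK_phiK_inr_inl`, scale displayed) and ANY coarse presentation `fμ` of the `M`-slots in the finest torus
`T = towerTorus Lc M (n+1)` reading `a ↦ (Lc^{n+1} • a.1, inr a.2)`:
`(∏ stepScale) • (perF T K).submatrix fμ (b ↦ (b.1, inl b.2)) = s • compRows Lc M lev rs (n+1)`. -/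
theorem smul_perF_submatrix_eq_smul_compRows (n : ℕ) (M : Fin (d + 1) → ℕ) [∀ μ, NeZero (M μ)] (lev : ℕ → ℕ)
    (rs : ℕ → (Fin (d + 1) → ℕ)) (hrs : ∀ k, rs k ∈ box (d + 1) Lc) (r : ℕ → (Fin (d + 1) → ℕ))
    (hr : ∀ i j : ℕ, i + j = n → r i = rs (j + 1)) (s : ℝ) {K : MKer (d + 1) (Fib d)}
    (hK : ∀ (x w : Fin (d + 1) → ℤ) (κ β : Fin (d + 1)), K x w (Sum.inr κ) (Sum.inl β)
      = if Torus.proj (bigRatio Lc n) x = 0 then s * compLinAvgAt r Lc (n + 1) (delta1 β w) κ (quo (bigRatio Lc n) x) else 0)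
    (fμ : ↥(pbox M) × Fin (d + 1) → Idx (towerTorus Lc M (n + 1)) (Fib d))
    (hfμ₁ : ∀ a, ((fμ a).1 : Fin (d + 1) → ℤ) = (bigRatio Lc n : ℤ) • (a.1 : Fin (d + 1) → ℤ)) (hfμ₂ : ∀ a, (fμ a).2 = Sum.inr a.2) :
    (∏ i ∈ Finset.range (n + 1), stepScale d Lc (lev (i + 1))) •
        (perF (towerTorus Lc M (n + 1)) K).submatrix fμ
          (fun b : ↥(pbox (towerTorus Lc M (n + 1))) × Fin (d + 1) => ((b.1, Sum.inl b.2) : Idx (towerTorus Lc M (n + 1)) (Fib d)))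
      = s • compRows Lc M lev rs (n + 1) := by
  haveI : NeZero (bigRatio Lc n) := ⟨by rw [bigRatio_eq_pow]; exact pow_ne_zero _ (NeZero.ne Lc)⟩
  ext ⟨x, κ⟩ ⟨z, β⟩
  rw [Matrix.smul_apply, Matrix.smul_apply, Matrix.submatrix_apply, perF_apply, hfμ₁, hfμ₂, perZ_apply,
    compRows_apply_eq_tsum Lc n M lev rs hrs r hr x κ z β, smul_eq_mul, smul_eq_mul]
  have hp : Torus.proj (bigRatio Lc n) ((bigRatio Lc n : ℤ) • (x : Fin (d + 1) → ℤ)) = 0 := proj_zsmul (N := bigRatio Lc n) _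
  have hq : quo (bigRatio Lc n) ((bigRatio Lc n : ℤ) • (x : Fin (d + 1) → ℤ)) = (x : Fin (d + 1) → ℤ) := quo_zsmul (N := bigRatio Lc n) _
  simp only [hK, if_pos hp, hq]
  rw [tsum_mul_left]
  ring

/-- [folklore] the same ON THE NOSE when the kernel's border carries exactly the tower's scale `∏_{i<n+1} stepScale d Lc (lev (i+1))`:
`(perF T K).submatrix fμ (b ↦ (b.1, inl b.2)) = compRows Lc M lev rs (n+1)` — the `hQ`-type block identification of a lattice chart against the
tower's composite averaging rows. -/
theorem perF_submatrix_eq_compRows (n : ℕ) (M : Fin (d + 1) → ℕ) [∀ μ, NeZero (M μ)] (lev : ℕ → ℕ)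
    (rs : ℕ → (Fin (d + 1) → ℕ)) (hrs : ∀ k, rs k ∈ box (d + 1) Lc) (r : ℕ → (Fin (d + 1) → ℕ))
    (hr : ∀ i j : ℕ, i + j = n → r i = rs (j + 1)) {K : MKer (d + 1) (Fib d)}
    (hK : ∀ (x w : Fin (d + 1) → ℤ) (κ β : Fin (d + 1)), K x w (Sum.inr κ) (Sum.inl β)
      = if Torus.proj (bigRatio Lc n) x = 0 then
          (∏ i ∈ Finset.range (n + 1), stepScale d Lc (lev (i + 1))) * compLinAvgAt r Lc (n + 1) (delta1 β w) κ (quo (bigRatio Lc n) x)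
        else 0)
    (fμ : ↥(pbox M) × Fin (d + 1) → Idx (towerTorus Lc M (n + 1)) (Fib d))
    (hfμ₁ : ∀ a, ((fμ a).1 : Fin (d + 1) → ℤ) = (bigRatio Lc n : ℤ) • (a.1 : Fin (d + 1) → ℤ)) (hfμ₂ : ∀ a, (fμ a).2 = Sum.inr a.2) :
    (perF (towerTorus Lc M (n + 1)) K).submatrix fμ
        (fun b : ↥(pbox (towerTorus Lc M (n + 1))) × Fin (d + 1) => ((b.1, Sum.inl b.2) : Idx (towerTorus Lc M (n + 1)) (Fib d)))
      = compRows Lc M lev rs (n + 1) := by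
  have hS : (∏ i ∈ Finset.range (n + 1), stepScale d Lc (lev (i + 1))) ≠ 0 :=
    Finset.prod_ne_zero_iff.2 fun i _ => BorderedHessian.stepScale_ne_zero _
  have h := smul_perF_submatrix_eq_smul_compRows Lc n M lev rs hrs r hr _ hK fμ hfμ₁ hfμ₂
  exact smul_right_injective _ hS h

/-- [folklore] **THE ENTRIES OF THE DOOR's `𝔔₀ = Q₂₀ * compRows` AS PERIOD SUMS** (system N, one more step on top read through a slot presentation
`a ↦ (pμ a, inr (mμ a))`, `proj Lc (pμ a) = 0`): `(Q₂₀ * compRows Lc M lev rs (n+1)) a (z,β) = (∏_{i<n+2} stepScale d Lc (lev i)) · Σ'_t compLinAvgAt r Lc (n+2)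
δ_{(β, z + T∘t)} (mμ a) (pμ a ∕ Lc)`, root dictionary `r i = rs j` for `i + j = n + 1`. -/
theorem topStep_mul_compRows_apply_eq_tsum (n : ℕ) (M : Fin (d + 1) → ℕ) [∀ μ, NeZero (M μ)] (lev : ℕ → ℕ)
    (rs : ℕ → (Fin (d + 1) → ℕ)) (hrs : ∀ k, rs k ∈ box (d + 1) Lc) (r : ℕ → (Fin (d + 1) → ℕ))
    (hr : ∀ i j : ℕ, i + j = n + 1 → r i = rs j) {κ' : Type*} [Fintype κ'] (pμ : κ' → ↥(pbox M)) (mμ : κ' → Fin (d + 1))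
    (hpμ : ∀ a, Torus.proj Lc ((pμ a : ↥(pbox M)) : Fin (d + 1) → ℤ) = 0) (a : κ')
    (z : ↥(pbox (towerTorus Lc M (n + 1)))) (β : Fin (d + 1)) :
    ((perF M (bhKStepAt d (toSite (rs 0)) Lc (lev 0))).submatrix (fun a : κ' => ((pμ a, Sum.inr (mμ a)) : Idx M (Fib d)))
          (fun b : ↥(pbox M) × Fin (d + 1) => ((b.1, Sum.inl b.2) : Idx M (Fib d))) * compRows Lc M lev rs (n + 1)) a (z, β)
      = (∏ i ∈ Finset.range (n + 2), stepScale d Lc (lev i)) *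
          ∑' t : Fin (d + 1) → ℤ, compLinAvgAt r Lc (n + 2) (delta1 β (translate (towerTorus Lc M (n + 1)) (z : Fin (d + 1) → ℤ) t)) (mμ a)
            (quo Lc ((pμ a : ↥(pbox M)) : Fin (d + 1) → ℤ)) := by
  classical
  -- the entry is the action on the periodic indicator of `(β, z)`
  have hA : ∀ (l : Fin (d + 1)) (w t : Fin (d + 1) → ℤ),
      (fun l w => delta1 β (z : Fin (d + 1) → ℤ) l (wrap (towerTorus Lc M (n + 1)) w)) l (translate (towerTorus Lc M (n + 1)) w t)
        = (fun l w => delta1 β (z : Fin (d + 1) → ℤ) l (wrap (towerTorus Lc M (n + 1)) w)) l w := fun l w t => by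
    show delta1 β _ l (wrap _ (translate _ w t)) = delta1 β _ l (wrap _ w)
    rw [B6Lemma24Torus.wrap_congr (x' := w)]
    intro i
    rw [translate_apply]
    exact ⟨t i, by ring⟩
  have hval : ∀ q : ↥(pbox (towerTorus Lc M (n + 1))) × Fin (d + 1),
      (fun l w => delta1 β (z : Fin (d + 1) → ℤ) l (wrap (towerTorus Lc M (n + 1)) w)) q.2 (q.1 : Fin (d + 1) → ℤ)
        = if q = (z, β) then 1 else 0 := fun q => by
    show delta1 β _ q.2 (wrap _ _) = _
    rw [wrap_eq_self q.1.2, delta1_apply]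
    obtain ⟨w, l⟩ := q
    by_cases h : (w, l) = (z, β)
    · rw [if_pos h, if_pos]
      obtain ⟨h1, h2⟩ := Prod.mk.inj h
      exact ⟨h2, by rw [h1]⟩
    · rw [if_neg h, if_neg]
      rintro ⟨h2, h1⟩
      exact h (Prod.ext (Subtype.ext h1) h2)
  have hact := sum_topStep_mul_compRows_mul_periodic Lc n M lev rs hrs r hr pμ mμ hpμ
    (fun l w => delta1 β (z : Fin (d + 1) → ℤ) l (wrap (towerTorus Lc M (n + 1)) w)) hA a
  simp only [hval, mul_ite, mul_one, mul_zero, Finset.sum_ite_eq', Finset.mem_univ, if_true] at hact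
  rw [hact]
  -- exchange the period sum (in-block roots agreeing with `r` on the levels used)
  set r' : ℕ → (Fin (d + 1) → ℕ) := fun i => if i ≤ n + 1 then r i else rs 0 with hr'def
  have hr'box : ∀ k, r' k ∈ box (d + 1) Lc := fun k => by
    simp only [hr'def]
    split_ifs with hk
    · rw [hr k (n + 1 - k) (by omega)]; exact hrs _
    · exact hrs 0
  have hagree : ∀ i, i < n + 2 → r i = r' i := fun i hi => by
    simp only [hr'def]; rw [if_pos (by omega)]
  have hLc : 0 < Lc := Nat.pos_of_ne_zero (NeZero.ne Lc)
  rw [compLinAvgAt_congr_roots Lc (n + 2) hagree,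
    ← tsum_compLinAvgAt_delta1_translate hLc r' hr'box (n + 2) (towerTorus Lc M (n + 1)) β z (mμ a) _]
  congr 1
  refine tsum_congr fun t => ?_
  rw [compLinAvgAt_congr_roots Lc (n + 2) hagree]

/-- [folklore] **THE `perF` PACKAGING FOR THE DOOR's `𝔔₀` (system N)**: for ANY lattice kernel `K` whose multiplier–field block is `s ·` the `n+2`-fold composite
rooted linear averaging read at the coarse points of scale `bigRatio Lc (n+1) = Lc^{n+2}`, and ANY slot presentation `fN : κ′ → Idx T (Fib d)` reading
`a ↦ (Lc^{n+1} • pμ a, inr (mμ a))` over the door's `M`-slots `(pμ, mμ)` (`proj Lc (pμ a) = 0`):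
`(∏_{i<n+2} stepScale d Lc (lev i)) • (perF T K).submatrix fN (ff) = s • (Q₂₀ * compRows Lc M lev rs (n+1))`. -/
theorem smul_perF_submatrix_eq_smul_topStep_mul_compRows (n : ℕ) (M : Fin (d + 1) → ℕ) [∀ μ, NeZero (M μ)] (lev : ℕ → ℕ)
    (rs : ℕ → (Fin (d + 1) → ℕ)) (hrs : ∀ k, rs k ∈ box (d + 1) Lc) (r : ℕ → (Fin (d + 1) → ℕ))
    (hr : ∀ i j : ℕ, i + j = n + 1 → r i = rs j) {κ' : Type*} [Fintype κ'] (pμ : κ' → ↥(pbox M)) (mμ : κ' → Fin (d + 1))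
    (hpμ : ∀ a, Torus.proj Lc ((pμ a : ↥(pbox M)) : Fin (d + 1) → ℤ) = 0) (s : ℝ) {K : MKer (d + 1) (Fib d)}
    (hK : ∀ (x w : Fin (d + 1) → ℤ) (κ β : Fin (d + 1)), K x w (Sum.inr κ) (Sum.inl β)
      = if Torus.proj (bigRatio Lc (n + 1)) x = 0 then s * compLinAvgAt r Lc (n + 2) (delta1 β w) κ (quo (bigRatio Lc (n + 1)) x) else 0)
    (fN : κ' → Idx (towerTorus Lc M (n + 1)) (Fib d))
    (hfN₁ : ∀ a, ((fN a).1 : Fin (d + 1) → ℤ) = (bigRatio Lc n : ℤ) • ((pμ a : ↥(pbox M)) : Fin (d + 1) → ℤ)) (hfN₂ : ∀ a, (fN a).2 = Sum.inr (mμ a)) :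
    (∏ i ∈ Finset.range (n + 2), stepScale d Lc (lev i)) •
        (perF (towerTorus Lc M (n + 1)) K).submatrix fN
          (fun b : ↥(pbox (towerTorus Lc M (n + 1))) × Fin (d + 1) => ((b.1, Sum.inl b.2) : Idx (towerTorus Lc M (n + 1)) (Fib d)))
      = s • ((perF M (bhKStepAt d (toSite (rs 0)) Lc (lev 0))).submatrix (fun a : κ' => ((pμ a, Sum.inr (mμ a)) : Idx M (Fib d)))
          (fun b : ↥(pbox M) × Fin (d + 1) => ((b.1, Sum.inl b.2) : Idx M (Fib d))) * compRows Lc M lev rs (n + 1)) := by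
  haveI : NeZero (bigRatio Lc (n + 1)) := ⟨by rw [bigRatio_eq_pow]; exact pow_ne_zero _ (NeZero.ne Lc)⟩
  ext a ⟨z, β⟩
  rw [Matrix.smul_apply, Matrix.smul_apply, Matrix.submatrix_apply, perF_apply, hfN₁, hfN₂, perZ_apply,
    topStep_mul_compRows_apply_eq_tsum Lc n M lev rs hrs r hr pμ mμ hpμ a z β, smul_eq_mul, smul_eq_mul]
  -- the slot's finest-lattice point is a coarse point of scale `bigRatio Lc (n+1) = bigRatio Lc n * Lc`
  have hx : (bigRatio Lc n : ℤ) • ((pμ a : ↥(pbox M)) : Fin (d + 1) → ℤ)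
      = (bigRatio Lc (n + 1) : ℤ) • quo Lc ((pμ a : ↥(pbox M)) : Fin (d + 1) → ℤ) := by
    conv_lhs => rw [eq_zsmul_quo_of_proj (hpμ a)]
    rw [smul_smul, TorusCompositeObjects.bigRatio_succ, Nat.cast_mul]
  have hp : Torus.proj (bigRatio Lc (n + 1)) ((bigRatio Lc n : ℤ) • ((pμ a : ↥(pbox M)) : Fin (d + 1) → ℤ)) = 0 := by
    rw [hx]; exact proj_zsmul (N := bigRatio Lc (n + 1)) _
  have hq : quo (bigRatio Lc (n + 1)) ((bigRatio Lc n : ℤ) • ((pμ a : ↥(pbox M)) : Fin (d + 1) → ℤ))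
      = quo Lc ((pμ a : ↥(pbox M)) : Fin (d + 1) → ℤ) := by
    rw [hx]; exact quo_zsmul (N := bigRatio Lc (n + 1)) _
  simp only [hK, if_pos hp, hq]
  rw [tsum_mul_left]
  ring

/-- [folklore] the same ON THE NOSE when the kernel's border carries exactly the scale `∏_{i<n+2} stepScale d Lc (lev i)`: `(perF T K).submatrix fN (ff) = Q₂₀ * compRows …`
— the `hQ`-type block identification of system N (`𝔔₀`). -/
theorem perF_submatrix_eq_topStep_mul_compRows (n : ℕ) (M : Fin (d + 1) → ℕ) [∀ μ, NeZero (M μ)] (lev : ℕ → ℕ)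
    (rs : ℕ → (Fin (d + 1) → ℕ)) (hrs : ∀ k, rs k ∈ box (d + 1) Lc) (r : ℕ → (Fin (d + 1) → ℕ))
    (hr : ∀ i j : ℕ, i + j = n + 1 → r i = rs j) {κ' : Type*} [Fintype κ'] (pμ : κ' → ↥(pbox M)) (mμ : κ' → Fin (d + 1))
    (hpμ : ∀ a, Torus.proj Lc ((pμ a : ↥(pbox M)) : Fin (d + 1) → ℤ) = 0) {K : MKer (d + 1) (Fib d)}
    (hK : ∀ (x w : Fin (d + 1) → ℤ) (κ β : Fin (d + 1)), K x w (Sum.inr κ) (Sum.inl β)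
      = if Torus.proj (bigRatio Lc (n + 1)) x = 0 then
          (∏ i ∈ Finset.range (n + 2), stepScale d Lc (lev i)) * compLinAvgAt r Lc (n + 2) (delta1 β w) κ (quo (bigRatio Lc (n + 1)) x)
        else 0)
    (fN : κ' → Idx (towerTorus Lc M (n + 1)) (Fib d))
    (hfN₁ : ∀ a, ((fN a).1 : Fin (d + 1) → ℤ) = (bigRatio Lc n : ℤ) • ((pμ a : ↥(pbox M)) : Fin (d + 1) → ℤ)) (hfN₂ : ∀ a, (fN a).2 = Sum.inr (mμ a)) :
    (perF (towerTorus Lc M (n + 1)) K).submatrix fN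
        (fun b : ↥(pbox (towerTorus Lc M (n + 1))) × Fin (d + 1) => ((b.1, Sum.inl b.2) : Idx (towerTorus Lc M (n + 1)) (Fib d)))
      = (perF M (bhKStepAt d (toSite (rs 0)) Lc (lev 0))).submatrix (fun a : κ' => ((pμ a, Sum.inr (mμ a)) : Idx M (Fib d)))
          (fun b : ↥(pbox M) × Fin (d + 1) => ((b.1, Sum.inl b.2) : Idx M (Fib d))) * compRows Lc M lev rs (n + 1) := by
  have hS : (∏ i ∈ Finset.range (n + 2), stepScale d Lc (lev i)) ≠ 0 :=
    Finset.prod_ne_zero_iff.2 fun i _ => BorderedHessian.stepScale_ne_zero _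
  have h := smul_perF_submatrix_eq_smul_topStep_mul_compRows Lc n M lev rs hrs r hr pμ mμ hpμ _ hK fN hfN₁ hfN₂
  exact smul_right_injective _ hS h

end Entries

end Summit.QuantumFields.BalabanUV.Beta.FP.TorusCompositeRowsLattice

end
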